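import Mathlib
import Summits.NavierStokesRegularity.NavierStokesRegularity.Theorems.TaoLadderRungTwoBreakBlowupRigidityOneMixedDrainPair
import Summits.NavierStokesRegularity.NavierStokesRegularity.Theorems.TaoLadderRungTwoBreakBlowupRigidityOneEnergyBound
import HarnessLib

/-!
# The ORTHANT WAKE FLOOR of the mixed-drain pair `M(u,v)`: along an exact flow from a one-shell datum, as long as the feed
  into shell `n` and the drain out of it keep their signs, the energy sent above shell `n` plus the energy of the drained
  twin `a_n` never exceeds `(u/v)²` times the energy parked in the undrained twin `b_n` — the structural wake of census item
  (MP) of K2(1) `TaoLadderRungTwoBreak.BlowupRigidityOne` (stmt-NavierStokesRegularity-20206; `--supports`)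

MODEL lattice ODEs only (Tao 2016 §4 (4.3), Lemma 4.1 (4.8)–(4.10)); nothing here is a statement about the Navier–Stokes
equations; NO item is closed.  DEF-FREE; ROUTE-INDEPENDENT MODULE (no `Theses` import).

THE ESTIMATE (`tailEnergy_add_sq_le_wake_mixedDrainPair`).  Let `X` be an exact flow of `M(u,v)` (`u, v > 0`) on `[0,T)` from the
one-shell datum `X₀` at shell `0` (derivatives within `[0,∞)`, no shells below `0`), `n ≥ 1`, `t < T`, and assume the SIGN
CONDITIONS on `[0,t]`: (S1) `a_{n−1} b_{n−1} ≥ 0` (the feed `F_{n−1} = 2Λ_{n−1}a_{n−1}b_{n−1}` into shell `n` is non-negative) and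
(S2) `b_n (u a_{n+1} + v b_{n+1}) ≥ 0` (the drain `D' = 2Λ_n b_n G_{n+1}` out of `a_n` is non-negative).  Then
  `Σ_i X₀ᵢ² − Σ_{j ≤ n} ‖x_j(t)‖² + a_n(t)² ≤ (u/v)² b_n(t)²`,
i.e. (by energy conservation, not used here) the energy above shell `n` plus `a_n²` is at most `(u/v)²·b_n²`.  PROOF: by the
exact law (`quadTerm_mixedDrainPair`) `ḃ_n = vF`, `ȧ_n = uF − D'`, and the partial energy `S_n` loses exactly the flux
`Ṡ_n = −2Λ_n⟪x_{n+1}, A x_n⟫ = −2 a_n D'` (`shellEnergy_hasDerivWithinAt`, telescoped); with `D := (u/v) b_n − a_n` one gets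
`D(0) = 0`, `Ḋ = D' ≥ 0`, and `V := (u/v)² b_n² − a_n² − (E₀ − S_n)` has `V(0) = 0`, `V̇ = 2u F D ≥ 0`.

READING for (MP).  Under (S1)–(S2) on every shell the wake kept in shell `n` is at least `(v/u)²` of all the energy that ever
passes above it, so the transmitted energy decays geometrically at the ε₀-INDEPENDENT ratio `(1 + (v/u)²)⁻¹` — the cell's BP-D
wake mechanism made structural; but the orthant is NOT invariant for `M(u,v)` (the drain on `a_n` is not proportional to
`a_n`), so this is a conditional floor, and deciding (MP) means controlling the sign changes.

HONEST LABEL: a conditional a-priori estimate for one explicit table family; no stub, crux, rung or summit is proved; rung 0.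
-/

noncomputable section

-- the summit and its single sub-problem share the name (CONVENTIONS §1)
set_option linter.dupNamespace false

open Set Filter Topology MeasureTheory
open scoped RealInnerProductSpace

namespace Summit.NavierStokesRegularity.NavierStokesRegularity.Theorems

namespace BlowupRigidityOne

open Literature.Analysis.FluidPDE Literature.Analysis.FluidPDE.TaoCascade

/-- The outflow pairing of `M(u,v)`: `⟪y, A x⟫ = (u y_0 + v y_1)·(2 x_0 x_1)` — what the shell above (holding `y`) receives
from the shell holding `x`. [cite: Tao2016AveragedNS, §4 (4.1), Lemma 4.1 (4.9); cell vocabulary (`tableA`)] -/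
theorem inner_tableA_mixedDrainPair (u v : ℝ) (y x : Em 4) :
    ⟪y, tableA (fun (i₁ i₂ i₃ : Fin 4) (μ : ℤ × ℤ × ℤ) => if μ = ((0 : ℤ), (0 : ℤ), (1 : ℤ)) then
        (if (i₁ = 0 ∧ i₂ = 1) ∨ (i₁ = 1 ∧ i₂ = 0) then (if i₃ = 0 then u else if i₃ = 1 then v else 0) else 0)
      else if μ = ((1 : ℤ), (0 : ℤ), (0 : ℤ)) then
        (if i₁ = 0 ∧ i₂ = 1 ∧ i₃ = 0 then -u else if i₁ = 1 ∧ i₂ = 1 ∧ i₃ = 0 then -v else 0)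
      else if μ = ((0 : ℤ), (1 : ℤ), (0 : ℤ)) then
        (if i₁ = 1 ∧ i₂ = 0 ∧ i₃ = 0 then -u else if i₁ = 1 ∧ i₂ = 1 ∧ i₃ = 0 then -v else 0) else 0) x⟫ = (u * y 0 + v * y 1) * (2 * (x 0 * x 1)) := by
  rw [PiLp.inner_apply]
  simp only [Fin.sum_univ_four, tableA_apply, qform_mixedDrainPair_feed, RCLike.inner_apply, conj_trivial]
  simp [show (2 : Fin 4) ≠ 0 by decide, show (2 : Fin 4) ≠ 1 by decide, show (3 : Fin 4) ≠ 0 by decide,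
    show (3 : Fin 4) ≠ 1 by decide]
  ring

/-- **ORTHANT WAKE FLOOR for `M(u,v)`.**  Along an exact flow of the mixed-drain pair from a one-shell datum at shell `0`,
for `n ≥ 1` and `t < T`: if on `[0,t]` the feed into shell `n` and the drain out of `a_n` are non-negative ((S1), (S2)), then
`Σ_i X₀ᵢ² − Σ_{j≤n} ‖x_j(t)‖² + a_n(t)² ≤ (u/v)² b_n(t)²`.
[cite: Tao2016AveragedNS, §4 (4.3), Lemma 4.1 (4.8)–(4.10) (shell energy balance); cell vocabulary (census item (MP))] -/
theorem tailEnergy_add_sq_le_wake_mixedDrainPair {u v ε₀ T : ℝ} (hu : 0 < u) (hv : 0 < v) (hε : 0 < ε₀)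
    {X : Fin 4 → ℤ → ℝ → ℝ} {X₀ : Fin 4 → ℝ}
    (hder : ∀ i k, ∀ t ∈ Ico 0 T, HasDerivWithinAt (X i k) (quadTerm ε₀ (fun (i₁ i₂ i₃ : Fin 4) (μ : ℤ × ℤ × ℤ) => if μ = ((0 : ℤ), (0 : ℤ), (1 : ℤ)) then
        (if (i₁ = 0 ∧ i₂ = 1) ∨ (i₁ = 1 ∧ i₂ = 0) then (if i₃ = 0 then u else if i₃ = 1 then v else 0) else 0)
      else if μ = ((1 : ℤ), (0 : ℤ), (0 : ℤ)) then
        (if i₁ = 0 ∧ i₂ = 1 ∧ i₃ = 0 then -u else if i₁ = 1 ∧ i₂ = 1 ∧ i₃ = 0 then -v else 0)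
      else if μ = ((0 : ℤ), (1 : ℤ), (0 : ℤ)) then
        (if i₁ = 1 ∧ i₂ = 0 ∧ i₃ = 0 then -u else if i₁ = 1 ∧ i₂ = 1 ∧ i₃ = 0 then -v else 0) else 0) X i k t) (Ici 0) t)
    (hinit : ∀ i k, X i k 0 = if k = 0 then X₀ i else 0)
    (hlow : ∀ i k t, k < 0 → X i k t = 0)
    {n : ℕ} (hn : 1 ≤ n) {t : ℝ} (ht : t ∈ Ico 0 T)
    (hS1 : ∀ τ ∈ Icc 0 t, 0 ≤ X 0 ((n : ℤ) - 1) τ * X 1 ((n : ℤ) - 1) τ)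
    (hS2 : ∀ τ ∈ Icc 0 t, 0 ≤ X 1 n τ * (u * X 0 ((n : ℤ) + 1) τ + v * X 1 ((n : ℤ) + 1) τ)) :
    (∑ i, X₀ i ^ 2) - ∑ j ∈ Finset.range (n + 1), ‖shellVec X (j : ℤ) t‖ ^ 2 + X 0 n t ^ 2 ≤
      (u / v) ^ 2 * X 1 n t ^ 2 := by
  have h1ε : 0 < 1 + ε₀ := by linarith
  have hL : 0 < bigLam ε₀ := bigLam_pos (by linarith)
  have hc := isCancellingCoeff_mixedDrainPair u v
  set Lm : ℝ := bigLam ε₀ ^ ((n : ℤ) - 1) with hLm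
  set Ln : ℝ := bigLam ε₀ ^ (n : ℤ) with hLn
  have hLm0 : 0 < Lm := zpow_pos hL _
  have hLn0 : 0 < Ln := zpow_pos hL _
  have hgain_m : (1 + ε₀) ^ ((5 : ℝ) * ((n : ℝ) - 1) / 2) = Lm := by
    have h := DSSOneShift.bigLam_zpow_eq_rpow h1ε ((n : ℤ) - 1)
    push_cast at h
    exact h
  have hgain_n : (1 + ε₀) ^ ((5 : ℝ) * (n : ℝ) / 2) = Ln := by
    have h := DSSOneShift.bigLam_zpow_eq_rpow h1ε (n : ℤ)
    push_cast at h
    exact h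
  -- the feed into shell `n` and the drain rate out of `a_n`
  set F : ℝ → ℝ := fun τ => 2 * Lm * (X 0 ((n : ℤ) - 1) τ * X 1 ((n : ℤ) - 1) τ) with hF
  set G : ℝ → ℝ := fun τ => u * X 0 ((n : ℤ) + 1) τ + v * X 1 ((n : ℤ) + 1) τ with hG
  -- the exact laws of `a_n`, `b_n`
  have hb : ∀ τ ∈ Ico (0 : ℝ) T, HasDerivWithinAt (X 1 n) (v * F τ) (Ici 0) τ := by
    intro τ hτ
    have h := hder 1 (n : ℤ) τ hτ
    rw [quadTerm_mixedDrainPair, if_neg (show (1 : Fin 4) ≠ 0 by decide), if_pos rfl] at h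
    refine h.congr_deriv ?_
    push_cast
    rw [hgain_m, hF]
    ring
  have ha : ∀ τ ∈ Ico (0 : ℝ) T,
      HasDerivWithinAt (X 0 n) (u * F τ - 2 * Ln * (X 1 n τ * G τ)) (Ici 0) τ := by
    intro τ hτ
    have h := hder 0 (n : ℤ) τ hτ
    rw [quadTerm_mixedDrainPair, if_pos rfl] at h
    refine h.congr_deriv ?_
    push_cast
    rw [hgain_m, hgain_n, hF, hG]
    ring
  -- the partial energy `S_n` and its flux
  set Sk : ℝ → ℝ := fun τ => ∑ j ∈ Finset.range (n + 1), ‖shellVec X (j : ℤ) τ‖ ^ 2 with hSkdef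
  have hxneg : ∀ τ, shellVec X (-1) τ = 0 := fun τ => by
    ext i; simp [shellVec, hlow i (-1) τ (by norm_num)]
  have hSder : ∀ τ ∈ Ico (0 : ℝ) T, HasDerivWithinAt Sk (-(2 * Ln * (2 * X 0 n τ * (X 1 n τ * G τ)))) (Ici 0) τ := by
    intro τ hτ
    set g : ℤ → ℝ := fun j => 2 * bigLam ε₀ ^ j * ⟪shellVec X (j + 1) τ, tableA (fun (i₁ i₂ i₃ : Fin 4) (μ : ℤ × ℤ × ℤ) => if μ = ((0 : ℤ), (0 : ℤ), (1 : ℤ)) then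
        (if (i₁ = 0 ∧ i₂ = 1) ∨ (i₁ = 1 ∧ i₂ = 0) then (if i₃ = 0 then u else if i₃ = 1 then v else 0) else 0)
      else if μ = ((1 : ℤ), (0 : ℤ), (0 : ℤ)) then
        (if i₁ = 0 ∧ i₂ = 1 ∧ i₃ = 0 then -u else if i₁ = 1 ∧ i₂ = 1 ∧ i₃ = 0 then -v else 0)
      else if μ = ((0 : ℤ), (1 : ℤ), (0 : ℤ)) then
        (if i₁ = 1 ∧ i₂ = 0 ∧ i₃ = 0 then -u else if i₁ = 1 ∧ i₂ = 1 ∧ i₃ = 0 then -v else 0) else 0) (shellVec X j τ)⟫ with hgdef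
    have hterm : ∀ j ∈ Finset.range (n + 1), HasDerivWithinAt (fun s => ‖shellVec X (j : ℤ) s‖ ^ 2)
        (g ((j : ℤ) - 1) - g j) (Ici 0) τ := by
      intro j _
      have h := shellEnergy_hasDerivWithinAt hε hc (k := (j : ℤ)) (fun i => hder i j τ hτ)
      simp only [hgdef, sub_add_cancel]
      exact h
    have hsum := HasDerivWithinAt.sum hterm
    have hg1 : g (-1) = 0 := by
      simp only [hgdef]
      rw [hxneg, tableA_zero hc, inner_zero_right, mul_zero]
    have htel : ∑ j ∈ Finset.range (n + 1), (g ((j : ℤ) - 1) - g j) = -(g n) := by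
      have h := Finset.sum_range_sub' (fun j : ℕ => g ((j : ℤ) - 1)) (n + 1)
      have e : ∀ j : ℕ, g (((j + 1 : ℕ) : ℤ) - 1) = g (j : ℤ) := fun j => by
        congr 1; push_cast; ring
      simp only [e] at h
      rw [h]
      push_cast
      rw [hg1, zero_sub]
    rw [htel, Finset.sum_fn] at hsum
    refine hsum.congr_deriv ?_
    simp only [hgdef, inner_tableA_mixedDrainPair, shellVec_apply, hG, hLn]
    ring
  -- initial values
  have hSk0 : Sk 0 = ∑ i, X₀ i ^ 2 := by
    simp only [hSkdef]
    rw [Finset.sum_eq_single 0]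
    · rw [EuclideanSpace.norm_eq, Real.sq_sqrt (Finset.sum_nonneg fun i _ => by positivity)]
      refine Finset.sum_congr rfl fun i _ => ?_
      simp [shellVec, hinit]
    · intro j _ hj
      have : shellVec X (j : ℤ) 0 = 0 := by
        ext i
        simp [shellVec, hinit, hj]
      rw [this, norm_zero, zero_pow two_ne_zero]
    · intro h; exact absurd (Finset.mem_range.2 (Nat.succ_pos n)) h
  have hn0 : (n : ℤ) ≠ 0 := by exact_mod_cast (by omega : n ≠ 0)
  have ha0 : X 0 n 0 = 0 := by rw [hinit, if_neg hn0]
  have hb0 : X 1 n 0 = 0 := by rw [hinit, if_neg hn0]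
  -- `D = (u/v) b_n - a_n` is non-decreasing from `0`, hence non-negative
  set D : ℝ → ℝ := fun τ => u / v * X 1 n τ - X 0 n τ with hDdef
  have hDder : ∀ τ ∈ Ico (0 : ℝ) T, HasDerivWithinAt D (2 * Ln * (X 1 n τ * G τ)) (Ici 0) τ := by
    intro τ hτ
    have h := ((hb τ hτ).const_mul (u / v)).sub (ha τ hτ)
    refine h.congr_deriv ?_
    field_simp
    ring
  have hmono : ∀ (φ φ' : ℝ → ℝ), (∀ τ ∈ Ico (0 : ℝ) T, HasDerivWithinAt φ (φ' τ) (Ici 0) τ) →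
      (∀ τ ∈ Icc (0 : ℝ) t, 0 ≤ φ' τ) → ∀ τ ∈ Icc (0 : ℝ) t, φ 0 ≤ φ τ := by
    intro φ φ' hφ hφ' τ hτ
    have hsub : Icc (0 : ℝ) t ⊆ Ico 0 T := fun s hs => ⟨hs.1, lt_of_le_of_lt hs.2 ht.2⟩
    have hcont : ContinuousOn φ (Icc 0 t) := fun s hs =>
      ((hφ s (hsub hs)).continuousWithinAt).mono Icc_subset_Ici_self
    have hmon : MonotoneOn φ (Icc 0 t) := by
      refine monotoneOn_of_hasDerivWithinAt_nonneg (convex_Icc 0 t) hcont (f' := φ') ?_ ?_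
      · intro s hs
        rw [interior_Icc] at hs
        have hsT : s ∈ Ico (0 : ℝ) T := ⟨hs.1.le, lt_trans hs.2 ht.2⟩
        exact ((hφ s hsT).hasDerivAt (Ici_mem_nhds hs.1)).hasDerivWithinAt
      · intro s hs
        rw [interior_Icc] at hs
        exact hφ' s ⟨hs.1.le, hs.2.le⟩
    exact hmon (left_mem_Icc.2 ht.1) hτ hτ.1
  have hDnn : ∀ τ ∈ Icc (0 : ℝ) t, 0 ≤ D τ := by
    intro τ hτ
    have h := hmono D (fun s => 2 * Ln * (X 1 n s * G s)) hDder
      (fun s hs => mul_nonneg (by positivity) (hS2 s hs)) τ hτ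
    have hD0 : D 0 = 0 := by simp only [hDdef, ha0, hb0, mul_zero, sub_zero]
    rwa [hD0] at h
  -- `V = (u/v)² b_n² - a_n² - (E₀ - S_n)` is non-decreasing from `0`
  set V : ℝ → ℝ := fun τ => (u / v) ^ 2 * X 1 n τ ^ 2 - X 0 n τ ^ 2 - ((∑ i, X₀ i ^ 2) - Sk τ) with hVdef
  have hVder : ∀ τ ∈ Ico (0 : ℝ) T, HasDerivWithinAt V (2 * u * F τ * D τ) (Ici 0) τ := by
    intro τ hτ
    have h1 := ((hb τ hτ).pow 2).const_mul ((u / v) ^ 2)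
    have h2 := (ha τ hτ).pow 2
    have h3 := (hSder τ hτ).const_sub (∑ i, X₀ i ^ 2)
    have h := (h1.sub h2).sub h3
    refine h.congr_deriv ?_
    simp only [hDdef]
    push_cast
    field_simp
    ring
  have hV0 : V 0 = 0 := by
    simp only [hVdef, ha0, hb0, hSk0]
    ring
  have hVt := hmono V (fun s => 2 * u * F s * D s) hVder (fun s hs => by
    have hF0 : 0 ≤ F s := by
      simp only [hF]
      exact mul_nonneg (by positivity) (hS1 s hs)
    have := hDnn s hs
    positivity) t ⟨ht.1, le_rfl⟩
  rw [hV0] at hVt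
  simp only [hVdef, hSkdef] at hVt
  linarith

end BlowupRigidityOne

end Summit.NavierStokesRegularity.NavierStokesRegularity.Theorems

end
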